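/-
Copyright: the b2b-balaban T⁴-continuum CRUX team, row NE7b OWNER lineage `t4-ne7b-p1` (gen 124). Project licence.
-/
import Summits.QuantumFields.BalabanUV.T4Continuum.Spine.NE7b.SupZdKernelNeumann
import Summits.QuantumFields.BalabanUV.T4Continuum.Spine.NE7b.SupZdPerturbedCoarseEntries
import Summits.QuantumFields.BalabanUV.T4Continuum.Spine.NE7b.SupZdCoarseInverseIdentities

/-!
# THE PERTURBED NEXT-SCALE HESSIAN ON `ℤ^d`, SHARPENED: `N_K = T_K⁻¹` EXISTS TWO-SIDEDLY, IS `O(ε)`-CLOSE TO `M = T⁻¹` WITH EXPONENTIAL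
# DECAY — `|N_K(b,c) − M(b,c)| ≤ 2C_M′θ_N·e^{−ν|b−c|₁}`, `θ_N ∝ ε` — AND IS UNIQUE AMONG EXPONENTIALLY DECAYING ONE-SIDED INVERSES OF `T_K`;
# same hypotheses and constants as (218) (three smallness conditions on `ε`, constants from `(d, a, λ, Λ)` ONLY); the bound is (217)'s
# fixed-point form `N_K + M(E_KN_K) = M` read through two profile steps, uniqueness is (217)'s `L = N` (row NE7b, node U5c;
# (186)∕(194)∕(195)∕(216)∕(217) BY NAME; [folklore])

Cell `pub-balaban`, sub-cell `t4`, spine estimate NE7b (`T4WeightBudget.RelWeightBound`; the cell's OWN estimate — NOT PRINTED in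
[Bałaban 1983–89], NOT PROVED).  Crux-route work under `Spine/NE7b/` by the row OWNER (`t4-ne7b-p1` gen 124, file (219)) under FREEZE
(0)'s crux-prover clause; NOTHING of Bałaban's is named as a Lean object, valued or asserted; no `T4Continuum/Support` leaf typed; no `def`,
no notation (`T`, `T_K`, `E_K`, `θ`, `θ_N`, `C_M′ = c₁e^{νd}K_{δ₁−ν}` WRITTEN OUT; `M`, `Ψ`, `Ψ^K` are DATA with their defining properties);
zero `sorry`.  Imports (BY NAME): the OWNER's (217) `…SupZdKernelNeumann` (`l1_profile_step`, `decaying_right_inverse`,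
`left_inverse_eq_right_inverse`), (216) `…SupZdPerturbedCoarseEntries` (`zd_perturbed_coarse_entries`), (195) `…SupZdCoarseInverseIdentities`
(`zd_coarse_mul_inverse`, `zd_coarse_inverse_mul`; through it (194) `zd_coarse_section_inverse`, (186) `zd_coarse_entry_decay`, (191)
`natAbs_sub_comm_sum`), Mathlib's `le_of_tendsto'`.  (218) `…SupZdPerturbedCoarseInverse` is NOT imported: this file re-runs its
construction (same engine, same data) keeping the fixed-point clause, and so SUPERSEDES (218)'s statement (every clause of (218) is a
clause here, with the same constants).

WHY (located).  § [NE7bP1-G124-HANDOFF] NEXT (3)(a)∕(b): the `H + K` column must be LIPSCHITZ IN `K` at the next scale — the relative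
weight bound compares the renormalised actions with and without the small nonlocal part.  (216) gave it for the block columns and the
coarse entries (`|T_K − T| = O(ε)` with decay); this file gives it for the next-scale Hessian `(n+1)^dN_K` itself: from (217)'s fixed
point `N_K − M = −M(E_KN_K)`, the profile step for `E_K` on `N_K`'s profile (`|E_KN_K(·,c)| ≤ L_E·2C_M′e^{−ν|·−c|₁}`,
`L_E = (4C_PK_{δ₀−μ}θ)e^{νd}K_{μ−ν}`) and then for `M` (`C_M′`) give `|N_K − M| ≤ 2C_M′·(C_M′L_E)·e^{−ν|b−c|₁}`, and `θ_N = C_M′L_E ≤ 1∕2` is the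
third smallness number, linear in `ε`.  Uniqueness makes `N_K` canonical (independent of the Neumann construction and of the side), which
is what a later torus → `ℤ^d` identification of the `H + K` tower needs.

WHAT IS PROVED ([folklore]): §1 **`fixed_point_lipschitz`** (abstract: the fixed-point form and three profiles bound `N − M`); §2
**`zd_perturbed_coarse_inverse_lipschitz`** (THE END: `∃ C₀ C_P δ₀ c₁ δ₁ > 0`: for ALL data as in (218): `∃ N` with the profile bound, both
inverse identities with summable rows, the `O(ε)` bound on `N − M` with decay, and uniqueness against every decaying right inverse and
every decaying left inverse); §3 toy.

HONEST (what this is NOT).  `N_K` is not claimed symmetric; no `ℓ²`∕operator-norm statement; Lipschitz only against `K = 0` (two kernels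
`K, K′` would go the same way through `T_K − T_{K′}`, not done); no torus → `ℤ^d` limit for the `H + K` tower; THREE smallness conditions
with the sup road's constants — NOT (163)'s energy threshold; the LINEAR column only; `d ≥ 3` only; scalar skeleton ((A3), NC-NE7b-α
UNRULED); nothing of the covariant propagators of [B4]–[B6]; nothing of Bałaban's asserted.  BY-NAME EFFECT ON THE WALL: NONE.  NE7b NOT
PRINTED ∕ NOT PROVED; spine PROVED 0∕9; rung (B)+1 — the programme's measures remain FINITE-torus statements; NOT the mass gap, NOT Clay.
HONEST DEPENDENCY: continuum YM on T⁴ ⇐ BetaPertH ∧ nine spine estimates (0∕9 proved); BetaPertH ⇐ (D1) ∧ (D4) ∧ CAP+tail; G-an2-4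
gates asym, D1 and NE2∕3∕4.
-/

set_option autoImplicit false

noncomputable section

namespace Summit.QuantumFields.BalabanUV.T4Continuum.NE7b.SupZdPerturbedCoarseInverseLipschitz

open Real Filter Topology
open scoped ENNReal
open Literature.MathematicalPhysics.QuantumFieldTheory.Balaban1983to89
open B6QGQLower276 (X e blk B)
open SupZdCoarseOperator (zd_coarse_entry_decay)
open SupZdCoarseForm (natAbs_sub_comm_sum)
open SupZdCoarseInverse (zd_coarse_section_inverse)
open SupZdCoarseInverseIdentities (zd_coarse_mul_inverse zd_coarse_inverse_mul)
open SupZdPerturbedCoarseEntries (zd_perturbed_coarse_entries)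
open SupZdKernelNeumann (l1_profile_step decaying_right_inverse left_inverse_eq_right_inverse)

variable {d : ℕ}

/-! ## §1. The fixed-point form controls `N − M` -/

/-- **`N − M` FROM THE FIXED POINT**: `|M(b,c)| ≤ C_Me^{−δ_M|b−c|₁}`, `|E(b,c)| ≤ ηe^{−γ_E|b−c|₁}`, `|N(b,c)| ≤ C_Ne^{−ν|b−c|₁}`
(`0 < ν < min(δ_M, γ_E)`) and `N(b,c) + Σ′_{b′}M(b,b′)Σ′_{c′}E(b′,c′)N(c′,c) = M(b,c)` ⟹
`|N(b,c) − M(b,c)| ≤ (C_Me^{νd}K_{δ_M−ν})(ηe^{νd}K_{γ_E−ν})C_N·e^{−ν|b−c|₁}` — (217)'s profile step twice. [folklore] -/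
theorem fixed_point_lipschitz {CM δM η γE CN ν : ℝ} (hCM : 0 ≤ CM) (hη : 0 ≤ η) (hν : 0 < ν) (hνM : ν < δM) (hνE : ν < γE)
    (M E N : X d → X d → ℝ)
    (hMd : ∀ b c, |M b c| ≤ CM * exp (-(δM * ∑ i, (((b i - c i).natAbs : ℕ) : ℝ))))
    (hE : ∀ b c, |E b c| ≤ η * exp (-(γE * ∑ i, (((b i - c i).natAbs : ℕ) : ℝ))))
    (hN : ∀ b c, |N b c| ≤ CN * exp (-(ν * ∑ i, (((b i - c i).natAbs : ℕ) : ℝ))))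
    (hfix : ∀ b c, N b c + ∑' b' : X d, M b b' * ∑' c' : X d, E b' c' * N c' c = M b c) (b c : X d) :
    |N b c - M b c| ≤ (CM * exp (ν * d) * (2 * (1 - exp (-(δM - ν)))⁻¹) ^ d) * (η * exp (ν * d) * (2 * (1 - exp (-(γE - ν)))⁻¹) ^ d)
      * CN * exp (-(ν * ∑ i, (((b i - c i).natAbs : ℕ) : ℝ))) := by
  have hEN : ∀ b', |∑' c' : X d, E b' c' * N c' c| ≤ η * exp (ν * d) * (2 * (1 - exp (-(γE - ν)))⁻¹) ^ d * CN
      * exp (-(ν * ∑ i, (((b' i - c i).natAbs : ℕ) : ℝ))) := fun b' =>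
    (l1_profile_step (d := d) hη hν.le hνE E hE c (fun c' => N c' c) (fun c' => hN c' c) b').2
  have hMEN := (l1_profile_step (d := d) hCM hν.le hνM M hMd c (fun b' => ∑' c' : X d, E b' c' * N c' c) hEN b).2
  rw [show N b c - M b c = -(∑' b' : X d, M b b' * ∑' c' : X d, E b' c' * N c' c) by linear_combination hfix b c, abs_neg]
  calc _ ≤ _ := hMEN
    _ = _ := by ring

/-! ## §2. THE END: the perturbed coarse inverse is `O(ε)`-close to `M`, and unique in the decaying class -/

/-- **HEADLINE — `N_K = M + O(ε)` WITH DECAY, AND UNIQUENESS**: under EXACTLY the hypotheses of (218) (`d ≥ 3`, the road, unperturbed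
block columns `Ψ`, a cube limit `M`, `ε, γ, μ, ν` with the three smallness conditions, a kernel `K` of the class, perturbed block columns
`Ψ^K`), there is a kernel `N_K` with (218)'s profile bound and BOTH inverse identities for `T_K(b,c) = (n+1)^{−d}Σ_{q∈B n b}Ψ^K_c(q)`, which
moreover satisfies `|N_K(b,c) − M(b,c)| ≤ 2C_M′θ_N·e^{−ν|b−c|₁}` with `C_M′ = c₁e^{νd}K_{δ₁−ν}` and `θ_N = C_M′·(4C_PK_{δ₀−μ}θ)e^{νd}K_{μ−ν} ≤ 1∕2`
(`θ_N ∝ ε`), and is UNIQUE: every exponentially decaying right inverse and every exponentially decaying left inverse of `T_K` equals `N_K` —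
(217)'s engine (fixed-point form, §1) for the bound, (218) for a two-sided decaying inverse, (217)'s `L = N` for the identifications. [folklore] -/
theorem zd_perturbed_coarse_inverse_lipschitz (hd : 3 ≤ d) (a : ℝ) (ha : 0 < a) {lam Lam : ℝ} (hlam : lam < min 2 a) (hLam : 0 ≤ Lam) :
    ∃ C₀ CP δ₀ c₁ δ₁ : ℝ, 0 < C₀ ∧ 0 < CP ∧ 0 < δ₀ ∧ 0 < c₁ ∧ 0 < δ₁ ∧
    ∀ (n : ℕ) (V : X d → ℝ), (∀ p, -lam ≤ V p) → (∀ p, V p ≤ Lam) →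
    ∀ (Ψ : X d → X d → ℝ) (BΨ : X d → ℝ), (∀ c p, |Ψ c p| ≤ BΨ c) →
      (∀ c p, ((n : ℝ) + 1) ^ 2 * ∑ μ', (2 * Ψ c p - Ψ c (p + e μ') - Ψ c (p - e μ'))
        + a / ((n : ℝ) + 1) ^ d * ∑ q ∈ B n (blk n p), Ψ c q + V p * Ψ c p = if blk n p = c then 1 else 0) →
    ∀ (M : X d → X d → ℝ), (∀ b b' : X d, Tendsto (fun R : ℕ =>
      if h : b ∈ (Fintype.piFinset fun _ : Fin d => Finset.Icc (-(R : ℤ)) R) ∧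
          b' ∈ (Fintype.piFinset fun _ : Fin d => Finset.Icc (-(R : ℤ)) R)
        then (Matrix.of fun c c' : ↥(Fintype.piFinset fun _ : Fin d => Finset.Icc (-(R : ℤ)) R) =>
          (((n : ℝ) + 1) ^ d)⁻¹ * ∑ q ∈ B n (c : X d), Ψ (c' : X d) q)⁻¹ ⟨b, h.1⟩ ⟨b', h.2⟩ else 0)
      atTop (𝓝 (M b b'))) →
    ∀ (ε γ μ ν : ℝ), 0 ≤ ε → 0 < μ → μ < δ₀ → μ < γ → 0 < ν → ν < μ → ν < δ₁ →
      ε * (2 * (1 - exp (-γ))⁻¹) ^ d * C₀ ≤ 1 / 2 →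
      (CP * (2 * (1 - exp (-(δ₀ - μ)))⁻¹) ^ d) * (ε * exp (μ * d) * (2 * (1 - exp (-(γ - μ)))⁻¹) ^ d) ≤ 1 / 2 →
      (c₁ * exp (ν * d) * (2 * (1 - exp (-(δ₁ - ν)))⁻¹) ^ d)
        * ((4 * (CP * (2 * (1 - exp (-(δ₀ - μ)))⁻¹) ^ d)
            * ((CP * (2 * (1 - exp (-(δ₀ - μ)))⁻¹) ^ d) * (ε * exp (μ * d) * (2 * (1 - exp (-(γ - μ)))⁻¹) ^ d)))
          * exp (ν * d) * (2 * (1 - exp (-(μ - ν)))⁻¹) ^ d) ≤ 1 / 2 →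
    ∀ (K : X d → X d → ℝ), (∀ p q, |K p q| ≤ ε * exp (-(γ * ∑ i, (((p i - q i).natAbs : ℕ) : ℝ)))) →
    ∀ (ΨK : X d → X d → ℝ) (BΨK : X d → ℝ), (∀ c p, |ΨK c p| ≤ BΨK c) →
      (∀ c p, ((n : ℝ) + 1) ^ 2 * ∑ μ', (2 * ΨK c p - ΨK c (p + e μ') - ΨK c (p - e μ'))
        + a / ((n : ℝ) + 1) ^ d * ∑ q ∈ B n (blk n p), ΨK c q + V p * ΨK c p + ∑' q : X d, K p q * ΨK c q
          = if blk n p = c then 1 else 0) →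
    ∃ N : X d → X d → ℝ,
      (∀ b c, |N b c| ≤ 2 * (c₁ * exp (ν * d) * (2 * (1 - exp (-(δ₁ - ν)))⁻¹) ^ d) * exp (-(ν * ∑ i, (((b i - c i).natAbs : ℕ) : ℝ)))) ∧
      (∀ b c, Summable (fun b' : X d => ((((n : ℝ) + 1) ^ d)⁻¹ * ∑ q ∈ B n b, ΨK b' q) * N b' c) ∧
        ∑' b' : X d, ((((n : ℝ) + 1) ^ d)⁻¹ * ∑ q ∈ B n b, ΨK b' q) * N b' c = if b = c then 1 else 0) ∧
      (∀ b c, Summable (fun b' : X d => N b b' * ((((n : ℝ) + 1) ^ d)⁻¹ * ∑ q ∈ B n b', ΨK c q)) ∧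
        ∑' b' : X d, N b b' * ((((n : ℝ) + 1) ^ d)⁻¹ * ∑ q ∈ B n b', ΨK c q) = if b = c then 1 else 0) ∧
      -- `N_K − M` is `O(ε)` with decay
      (∀ b c, |N b c - M b c| ≤ 2 * (c₁ * exp (ν * d) * (2 * (1 - exp (-(δ₁ - ν)))⁻¹) ^ d)
        * ((c₁ * exp (ν * d) * (2 * (1 - exp (-(δ₁ - ν)))⁻¹) ^ d)
          * ((4 * (CP * (2 * (1 - exp (-(δ₀ - μ)))⁻¹) ^ d)
              * ((CP * (2 * (1 - exp (-(δ₀ - μ)))⁻¹) ^ d) * (ε * exp (μ * d) * (2 * (1 - exp (-(γ - μ)))⁻¹) ^ d)))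
            * exp (ν * d) * (2 * (1 - exp (-(μ - ν)))⁻¹) ^ d))
        * exp (-(ν * ∑ i, (((b i - c i).natAbs : ℕ) : ℝ)))) ∧
      -- uniqueness in the decaying class, on either side
      (∀ (N' : X d → X d → ℝ) (C' ν' : ℝ), 0 ≤ C' → 0 < ν' →
        (∀ b c, |N' b c| ≤ C' * exp (-(ν' * ∑ i, (((b i - c i).natAbs : ℕ) : ℝ)))) →
        ((∀ b c, ∑' b' : X d, ((((n : ℝ) + 1) ^ d)⁻¹ * ∑ q ∈ B n b, ΨK b' q) * N' b' c = if b = c then 1 else 0) →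
          ∀ b c, N' b c = N b c) ∧
        ((∀ b c, ∑' b' : X d, N' b b' * ((((n : ℝ) + 1) ^ d)⁻¹ * ∑ q ∈ B n b', ΨK c q) = if b = c then 1 else 0) →
          ∀ b c, N' b c = N b c)) := by
  classical
  obtain ⟨C₀, CP, δ₀, hC₀, hCP, hδ₀, H216⟩ := zd_perturbed_coarse_entries (d := d) hd a ha hlam hLam
  obtain ⟨CT, δT, hCT, hδT, H186⟩ := zd_coarse_entry_decay (d := d) hd a ha hlam hLam
  obtain ⟨c₁, δ₁, hc₁, hδ₁, H194⟩ := zd_coarse_section_inverse (d := d) hd a ha hlam hLam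
  refine ⟨C₀, CP, δ₀, c₁, δ₁, hC₀, hCP, hδ₀, hc₁, hδ₁, ?_⟩
  intro n V hV hV' Ψ BΨ hΨB hΨ M hM ε γ μ ν hε hμ hμδ hμγ hν hνμ hνδ hsmall1 hsmall2 hsmall3 K hK ΨK BΨK hΨKB hΨK
  obtain ⟨-, H2, H3⟩ := H216 n V hV hV' ε γ μ hε hμ hμδ hμγ hsmall1 hsmall2 K hK
  have hKδμ : 0 < (2 * (1 - exp (-(δ₀ - μ)))⁻¹) ^ d := pow_pos (mul_pos two_pos (inv_pos.2 (sub_pos.2 (exp_lt_one_iff.2 (by linarith))))) d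
  have hKγμ : 0 < (2 * (1 - exp (-(γ - μ)))⁻¹) ^ d := pow_pos (mul_pos two_pos (inv_pos.2 (sub_pos.2 (exp_lt_one_iff.2 (by linarith))))) d
  obtain ⟨CPK, hCPK⟩ : ∃ CPK : ℝ, CPK = CP * (2 * (1 - exp (-(δ₀ - μ)))⁻¹) ^ d := ⟨_, rfl⟩
  have hCPK0 : 0 < CPK := by rw [hCPK]; exact mul_pos hCP hKδμ
  obtain ⟨θ, hθ⟩ : ∃ θ : ℝ, θ = CPK * (ε * exp (μ * d) * (2 * (1 - exp (-(γ - μ)))⁻¹) ^ d) := ⟨_, rfl⟩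
  have hθ0 : 0 ≤ θ := by rw [hθ]; exact mul_nonneg hCPK0.le (mul_nonneg (mul_nonneg hε (exp_pos _).le) hKγμ.le)
  have hη : 0 ≤ 4 * CPK * θ := by positivity
  have hsmall3' : (c₁ * exp (ν * d) * (2 * (1 - exp (-(δ₁ - ν)))⁻¹) ^ d)
      * ((4 * CPK * θ) * exp (ν * d) * (2 * (1 - exp (-(μ - ν)))⁻¹) ^ d) ≤ 1 / 2 := by rw [hθ, hCPK]; exact hsmall3
  -- the three kernels
  obtain ⟨T, hT⟩ : ∃ T : X d → X d → ℝ, ∀ b c, T b c = (((n : ℝ) + 1) ^ d)⁻¹ * ∑ q ∈ B n b, Ψ c q := ⟨_, fun _ _ => rfl⟩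
  obtain ⟨TK, hTK⟩ : ∃ TK : X d → X d → ℝ, ∀ b c, TK b c = (((n : ℝ) + 1) ^ d)⁻¹ * ∑ q ∈ B n b, ΨK c q := ⟨_, fun _ _ => rfl⟩
  obtain ⟨E, hE⟩ : ∃ E : X d → X d → ℝ, ∀ b c, E b c = TK b c - T b c := ⟨_, fun _ _ => rfl⟩
  have hTE : ∀ b c, T b c + E b c = TK b c := fun b c => by rw [hE]; ring
  -- decay of `T` ((186)), `E` ((216) (iii)), `M` ((194)); `TM = 1 = MT` ((195)); `T_K` bounded ((216) (ii))
  have hTd : ∀ b c, |T b c| ≤ CT * exp (-(δT * ∑ i, (((b i - c i).natAbs : ℕ) : ℝ))) := fun b c => by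
    rw [hT]; exact H186 n V hV hV' Ψ BΨ hΨB hΨ b c
  have hEd : ∀ b c, |E b c| ≤ 4 * CPK * θ * exp (-(μ * ∑ i, (((b i - c i).natAbs : ℕ) : ℝ))) := by
    intro b c
    have h := (H3 c (ΨK c) (BΨK c) (hΨKB c) (hΨK c) (Ψ c) (BΨ c) (hΨB c) (hΨ c)).2 b
    rw [hE, hTK, hT, hθ, hCPK]
    exact h
  have hTKb : ∀ b c, |TK b c| ≤ 2 * CPK := fun b c => by
    rw [hTK, hCPK]
    exact ((H2 c (ΨK c) (BΨK c) (hΨKB c) (hΨK c)).2 b).trans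
      (mul_le_of_le_one_right (by positivity) (exp_le_one_iff.2 (neg_nonpos.2 (by positivity))))
  have hMd : ∀ b c, |M b c| ≤ c₁ * exp (-(δ₁ * ∑ i, (((b i - c i).natAbs : ℕ) : ℝ))) := fun b c =>
    le_of_tendsto' (hM b c).abs fun R => by
      split_ifs with h
      · exact (H194 n V hV hV' Ψ BΨ hΨB hΨ _ _ (Finset.Subset.refl _)).1 ⟨b, h.1⟩ ⟨c, h.2⟩
      · rw [abs_zero]; positivity
  have hTM : ∀ b c, ∑' b' : X d, T b b' * M b' c = if b = c then 1 else 0 := fun b c => by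
    simp only [hT]; exact (zd_coarse_mul_inverse hd a ha hlam hLam n V hV hV' Ψ BΨ hΨB hΨ M hM b c).2
  have hMT : ∀ b c, ∑' b' : X d, M b b' * T b' c = if b = c then 1 else 0 := fun b c => by
    simp only [hT]; exact (zd_coarse_inverse_mul hd a ha hlam hLam n V hV hV' Ψ BΨ hΨB hΨ M hM b c).2
  have hite : ∀ b c : X d, (if c = b then (1 : ℝ) else 0) = if b = c then 1 else 0 := by
    intro b c
    by_cases h : b = c
    · rw [if_pos h, if_pos h.symm]
    · rw [if_neg h, if_neg fun h' => h h'.symm]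
  -- (217) on `(T, M, E)`: the decaying RIGHT inverse
  obtain ⟨N, hNd, hNfix, hNid⟩ := decaying_right_inverse (d := d) hCT.le hδT hc₁.le hη hν hνδ hνμ T M E hTd hMd hEd hTM hsmall3'
  have hright : ∀ b c, Summable (fun b' : X d => TK b b' * N b' c) ∧ ∑' b' : X d, TK b b' * N b' c = if b = c then 1 else 0 := by
    intro b c
    obtain ⟨-, -, hs, -, hid⟩ := hNid b c
    simp only [hTE] at hs hid
    exact ⟨hs, hid⟩
  -- (217) on the TRANSPOSED data: a decaying LEFT inverse
  have hTdt : ∀ b c, |T c b| ≤ CT * exp (-(δT * ∑ i, (((b i - c i).natAbs : ℕ) : ℝ))) := fun b c => by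
    rw [natAbs_sub_comm_sum]; exact hTd c b
  have hMdt : ∀ b c, |M c b| ≤ c₁ * exp (-(δ₁ * ∑ i, (((b i - c i).natAbs : ℕ) : ℝ))) := fun b c => by
    rw [natAbs_sub_comm_sum]; exact hMd c b
  have hEdt : ∀ b c, |E c b| ≤ 4 * CPK * θ * exp (-(μ * ∑ i, (((b i - c i).natAbs : ℕ) : ℝ))) := fun b c => by
    rw [natAbs_sub_comm_sum]; exact hEd c b
  have hTMt : ∀ b c, ∑' b' : X d, T b' b * M c b' = if b = c then 1 else 0 := fun b c => by
    rw [show (fun b' : X d => T b' b * M c b') = fun b' => M c b' * T b' b from funext fun _ => mul_comm _ _, hMT c b]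
    exact hite b c
  obtain ⟨N', hN'd, -, hN'id⟩ := decaying_right_inverse (d := d) hCT.le hδT hc₁.le hη hν hνδ hνμ
    (fun b c => T c b) (fun b c => M c b) (fun b c => E c b) hTdt hMdt hEdt hTMt hsmall3'
  have hleft' : ∀ b c, Summable (fun b' : X d => N' b' b * TK b' c) ∧ ∑' b' : X d, N' b' b * TK b' c = if b = c then 1 else 0 := by
    intro b c
    obtain ⟨-, -, hs, -, hid⟩ := hN'id c b
    simp only [hTE] at hs hid
    rw [hite] at hid
    have e : (fun b' : X d => TK b' c * N' b' b) = fun b' => N' b' b * TK b' c := funext fun _ => mul_comm _ _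
    rw [e] at hs hid
    exact ⟨hs, hid⟩
  -- (217): left inverse = right inverse
  have hLd : ∀ b c, |N' c b| ≤ 2 * (c₁ * exp (ν * d) * (2 * (1 - exp (-(δ₁ - ν)))⁻¹) ^ d)
      * exp (-(ν * ∑ i, (((b i - c i).natAbs : ℕ) : ℝ))) := fun b c => by
    rw [natAbs_sub_comm_sum]; exact hN'd c b
  have hKν : 0 < (2 * (1 - exp (-(δ₁ - ν)))⁻¹) ^ d := pow_pos (mul_pos two_pos (inv_pos.2 (sub_pos.2 (exp_lt_one_iff.2 (by linarith))))) d
  have hCN : 0 ≤ 2 * (c₁ * exp (ν * d) * (2 * (1 - exp (-(δ₁ - ν)))⁻¹) ^ d) := by positivity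
  have hLN : ∀ b c, N' c b = N b c := fun b c =>
    left_inverse_eq_right_inverse (d := d) hCN hν (by positivity) hCN hν TK (fun b c => N' c b) N hTKb
      hLd hNd (fun b c => (hright b c).2) (fun b c => (hleft' b c).2) b c
  have hleft : ∀ b c, Summable (fun b' : X d => N b b' * TK b' c) ∧ ∑' b' : X d, N b b' * TK b' c = if b = c then 1 else 0 := by
    intro b c
    have h := hleft' b c
    simp only [hLN] at h
    exact h
  refine ⟨N, hNd, fun b c => by simp only [← hTK]; exact hright b c, fun b c => by simp only [← hTK]; exact hleft b c,
    fun b c => ?_, fun N' C' ν' hC' hν' hN'd => ⟨fun hN'r b c => ?_, fun hN'l b c => ?_⟩⟩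
  · -- §1 on the fixed-point form
    have h := fixed_point_lipschitz (d := d) hc₁.le hη hν hνδ hνμ M E N hMd hEd hNd (fun b c => (hNfix b c).2.2) b c
    rw [hθ, hCPK] at h
    calc _ ≤ _ := h
      _ = _ := by ring
  · -- a decaying right inverse `N′` equals `N` (`N` is a decaying left inverse)
    simp only [← hTK] at hN'r
    exact (left_inverse_eq_right_inverse (d := d) hCN hν (by positivity) hC' hν' TK N N' hTKb hNd hN'd hN'r
      (fun b c => (hleft b c).2) b c).symm
  · -- a decaying left inverse `N′` equals `N` (`N` is a decaying right inverse)
    simp only [← hTK] at hN'l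
    exact left_inverse_eq_right_inverse (d := d) hC' hν' (by positivity) hCN hν TK N' N hTKb hN'd hNd
      (fun b c => (hright b c).2) hN'l b c

/-! ## §3. Toy -/

/-- Toy (`d = 3`, `a = 1`, `λ = 0`, `Λ = 1`): the five constants exist. -/
example : ∃ C₀ CP δ₀ c₁ δ₁ : ℝ, 0 < C₀ ∧ 0 < CP ∧ 0 < δ₀ ∧ 0 < c₁ ∧ 0 < δ₁ :=
  let ⟨C₀, CP, δ₀, c₁, δ₁, h1, h2, h3, h4, h5, _⟩ :=
    zd_perturbed_coarse_inverse_lipschitz (d := 3) le_rfl 1 one_pos (lam := 0) (Lam := 1)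
      (by rw [min_eq_right (by norm_num : (1 : ℝ) ≤ 2)]; norm_num) zero_le_one
  ⟨C₀, CP, δ₀, c₁, δ₁, h1, h2, h3, h4, h5⟩

end Summit.QuantumFields.BalabanUV.T4Continuum.NE7b.SupZdPerturbedCoarseInverseLipschitz
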